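import Mathlib.RingTheory.PowerSeries.WeierstrassPreparation
import Summits.BirchSwinnertonDyer.Rank1Residual.ManinAdditive.CuspidalKummerCubeNoBlindLaws
import HarnessLib

/-!
# `3`-blindness is a UNIT-CUBE condition: the `Frac ℤ₃⟦q⟧` quantifier of `IsThreeAdicFracCube` is eliminable

Summit `BirchSwinnertonDyer`, route `ManinLocalTwoThree` (cell bsd-f2-manin), crux C3 `ManinPrimeToThreeAtNine` (stmt-BirchSwinnertonDyer-22968),
stub NB₃ / (BL) of `Lines/kato_shift_three.lean` (the blindness predicate `ThreeBlind W X₁ Y₁ := IsThreeAdicFracCube Θ♮_T`,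
`IsThreeAdicFracCube Θ := ∃ A B : ℤ₃⟦q⟧, B ≠ 0 ∧ Θ·B³ = A³`).  Refuter-1 §R66 Lemma 1 / recommendation R-2: at additive `3` the
Kummer cube series is `3`-integral with unit constant term, and then «cube in `Frac ℤ₃⟦q⟧`» ⟺ «cube of a UNIT of `ℤ₃⟦q⟧`».  This file
proves the underlying commutative algebra (a Gauss lemma for `n`-th powers in `A⟦X⟧`, `A` a complete local ring, via the UNIQUENESS
half of the Weierstrass preparation theorem, Mathlib `PowerSeries.IsWeierstrassFactorization.elim`) and the corollary:

* `exists_isUnit_pow_eq_of_mul_pow_eq_pow` — `A` complete local ring, `Θ ∈ A⟦X⟧ˣ`, `B̄ ≠ 0`, `Θ·Bⁿ = Aⁿ` ⟹ `Θ = Uⁿ`, `U` a unit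
  (two Weierstrass factorisations of `Aⁿ`: `f′ⁿ·h′ⁿ` and `fⁿ·(Θ hⁿ)`);
* `exists_isUnit_pow_eq_of_mul_pow_eq_pow_padicInt` — over `ℤ_p` the hypothesis `B̄ ≠ 0` is removed (`B ≠ 0` suffices: divide `A`, `B`
  by `p` while `B̄ = 0`, induction on the valuation of a non-zero coefficient);
* `isThreeAdicFracCube_iff_exists_isUnit_cube` — for `Θ ∈ ℚ⟦q⟧` with a `3`-integral lift `Θ₀ ∈ ℤ₃⟦q⟧` of unit constant term:
  `IsThreeAdicFracCube Θ ↔ ∃ U ∈ ℤ₃⟦q⟧ˣ, Θ₀ = U³`; `threeBlind_iff_exists_isUnit_cube` — the same for `ThreeBlind`.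

Nothing about BSD, Manin's conjecture or C3 is proved. [cite: Washington1997, Thm. 7.3 (Weierstrass preparation, uniqueness)]
-/

set_option autoImplicit false
set_option linter.dupNamespace false

noncomputable section

open scoped Classical
open PowerSeries IsLocalRing

namespace Summit.BirchSwinnertonDyer.BirchSwinnertonDyer.Theorems.ManinLocalTwoThree

/-! ### §1 The Gauss lemma for `n`-th powers over a complete local ring -/

section CompleteLocal

variable {A : Type*} [CommRing A] [IsLocalRing A] [IsAdicComplete (maximalIdeal A) A]

omit [IsAdicComplete (maximalIdeal A) A] in
/-- Powers of a Weierstrass factorisation. [folklore] -/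
theorem isWeierstrassFactorization_pow {g : A⟦X⟧} {f : Polynomial A} {h : A⟦X⟧} (H : g.IsWeierstrassFactorization f h)
    (n : ℕ) : (g ^ (n + 1)).IsWeierstrassFactorization (f ^ (n + 1)) (h ^ (n + 1)) := by
  induction n with
  | zero => simpa using H
  | succ n ih =>
    have := ih.mul H
    simpa [pow_succ] using this

/-- **Gauss lemma for `n`-th powers in `A⟦X⟧`** (`A` a complete local ring): if `Θ` is a unit of `A⟦X⟧`, `B` has non-zero
reduction and `Θ·Bⁿ = Aⁿ`, then `Θ = Uⁿ` for a unit `U` — by uniqueness of the Weierstrass factorisation of `Aⁿ`.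
[cite: Washington1997, Thm. 7.3] -/
theorem exists_isUnit_pow_eq_of_mul_pow_eq_pow (n : ℕ) {Θ A₀ B₀ : A⟦X⟧} (hΘ : IsUnit Θ)
    (hB : B₀.map (residue A) ≠ 0) (h : Θ * B₀ ^ n = A₀ ^ n) : ∃ U : A⟦X⟧, IsUnit U ∧ Θ = U ^ n := by
  cases n with
  | zero => exact ⟨1, isUnit_one, by simpa using h⟩
  | succ n =>
    -- the reduction of `A₀` is non-zero
    have hΘbar : IsUnit (Θ.map (residue A)) := hΘ.map _
    have hA : A₀.map (residue A) ≠ 0 := by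
      intro h0
      have h1 : (A₀ ^ (n + 1)).map (residue A) = 0 := by rw [map_pow, h0, zero_pow (Nat.succ_ne_zero n)]
      rw [← h, map_mul, map_pow] at h1
      rcases mul_eq_zero.mp h1 with h2 | h2
      · exact hΘbar.ne_zero h2
      · exact hB (pow_eq_zero_iff (Nat.succ_ne_zero n) |>.mp h2)
    obtain ⟨f, hB', HB⟩ := B₀.exists_isWeierstrassFactorization hB
    obtain ⟨f', hA', HA⟩ := A₀.exists_isWeierstrassFactorization hA
    have H1 : (A₀ ^ (n + 1)).IsWeierstrassFactorization (f' ^ (n + 1)) (hA' ^ (n + 1)) :=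
      isWeierstrassFactorization_pow HA n
    have HBn := isWeierstrassFactorization_pow HB n
    have H2 : (A₀ ^ (n + 1)).IsWeierstrassFactorization (f ^ (n + 1)) (Θ * hB' ^ (n + 1)) := by
      refine ⟨HBn.isDistinguishedAt, hΘ.mul HBn.isUnit, ?_⟩
      rw [← h, HBn.eq_mul]; ring
    obtain ⟨-, hh⟩ := H2.elim H1
    -- `Θ · hB'ⁿ = hA'ⁿ`
    obtain ⟨u, hu⟩ := HB.isUnit
    refine ⟨hA' * ↑u⁻¹, HA.isUnit.mul (Units.isUnit _), ?_⟩
    rw [mul_pow, ← hh, ← hu, mul_assoc, ← mul_pow, Units.mul_inv, one_pow, mul_one]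

end CompleteLocal

/-! ### §2 Over `ℤ_p`: removing the `p`-content -/

section Padic

variable {p : ℕ} [hp : Fact p.Prime]

/-- A power series over `ℤ_p` with zero reduction is `p` times a power series. [folklore] -/
theorem exists_eq_C_p_mul_of_map_residue_eq_zero {B : (ℤ_[p])⟦X⟧} (hB : B.map (residue ℤ_[p]) = 0) :
    ∃ B' : (ℤ_[p])⟦X⟧, B = C ((p : ℤ_[p])) * B' := by
  have hdvd : ∀ n, (p : ℤ_[p]) ∣ coeff n B := by
    intro n
    have h1 : residue ℤ_[p] (coeff n B) = 0 := by
      have := congrArg (coeff n) hB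
      simpa [coeff_map] using this
    have h2 : coeff n B ∈ maximalIdeal ℤ_[p] := by
      rw [← IsLocalRing.ker_residue]; exact h1
    rw [PadicInt.maximalIdeal_eq_span_p, Ideal.mem_span_singleton] at h2
    exact h2
  refine ⟨PowerSeries.mk fun n => (hdvd n).choose, ?_⟩
  ext n
  rw [coeff_C_mul, coeff_mk]
  exact (hdvd n).choose_spec

/-- **Gauss lemma for `n`-th powers in `ℤ_p⟦X⟧`**: `Θ ∈ ℤ_p⟦X⟧ˣ`, `B ≠ 0`, `Θ·Bⁿ = Aⁿ` ⟹ `Θ = Uⁿ` with `U` a unit (induction on the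
valuation of a non-zero coefficient of `B`: while `B̄ = 0` divide `A` and `B` by `p`). [cite: Washington1997, Thm. 7.3] -/
theorem exists_isUnit_pow_eq_of_mul_pow_eq_pow_padicInt (n : ℕ) {Θ A B : (ℤ_[p])⟦X⟧} (hΘ : IsUnit Θ) (hB : B ≠ 0)
    (h : Θ * B ^ n = A ^ n) : ∃ U : (ℤ_[p])⟦X⟧, IsUnit U ∧ Θ = U ^ n := by
  cases n with
  | zero => exact ⟨1, isUnit_one, by simpa using h⟩
  | succ n =>
    -- a non-zero coefficient of `B`
    obtain ⟨n₀, hn₀⟩ : ∃ n₀, coeff n₀ B ≠ 0 := by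
      by_contra hall
      push Not at hall
      exact hB (PowerSeries.ext fun k => by simpa using hall k)
    -- induction on its valuation
    suffices key : ∀ (k : ℕ) (A B : (ℤ_[p])⟦X⟧), coeff n₀ B ≠ 0 → (coeff n₀ B).valuation ≤ k →
        Θ * B ^ (n + 1) = A ^ (n + 1) → ∃ U : (ℤ_[p])⟦X⟧, IsUnit U ∧ Θ = U ^ (n + 1) from
      key _ A B hn₀ le_rfl h
    intro k
    induction k with
    | zero =>
      intro A B hB0 hval hAB
      refine exists_isUnit_pow_eq_of_mul_pow_eq_pow (n + 1) hΘ ?_ hAB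
      intro hbar
      have h1 : residue ℤ_[p] (coeff n₀ B) = 0 := by
        have := congrArg (coeff n₀) hbar; simpa [coeff_map] using this
      have h2 : coeff n₀ B ∈ maximalIdeal ℤ_[p] := by rw [← IsLocalRing.ker_residue]; exact h1
      have hu : IsUnit (coeff n₀ B) := by
        rw [PadicInt.isUnit_iff]
        have := (PadicInt.norm_eq_zpow_neg_valuation hB0)
        rw [this, Nat.le_zero.mp hval]; simp
      exact (IsLocalRing.mem_maximalIdeal _).mp h2 hu
    | succ k ih =>
      intro A B hB0 hval hAB
      by_cases hbar : B.map (residue ℤ_[p]) ≠ 0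
      · exact exists_isUnit_pow_eq_of_mul_pow_eq_pow (n + 1) hΘ hbar hAB
      rw [not_not] at hbar
      obtain ⟨B', rfl⟩ := exists_eq_C_p_mul_of_map_residue_eq_zero hbar
      -- then `Ā = 0` as well
      have hp0 : (p : ℤ_[p]) ≠ 0 := by exact_mod_cast hp.out.ne_zero
      have hCp : (C (p : ℤ_[p]) : (ℤ_[p])⟦X⟧) ≠ 0 := by
        intro h0; exact hp0 (by simpa using congrArg (coeff 0) h0)
      have hAbar : A.map (residue ℤ_[p]) = 0 := by
        have h1 : (A ^ (n + 1)).map (residue ℤ_[p]) = 0 := by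
          rw [← hAB, map_mul, map_pow, map_mul, map_C]
          have : residue ℤ_[p] (p : ℤ_[p]) = 0 := by
            rw [← RingHom.mem_ker, IsLocalRing.ker_residue, PadicInt.maximalIdeal_eq_span_p]
            exact Ideal.mem_span_singleton_self _
          rw [this]; simp
        rw [map_pow] at h1
        exact (pow_eq_zero_iff (Nat.succ_ne_zero n)).mp h1
      obtain ⟨A', rfl⟩ := exists_eq_C_p_mul_of_map_residue_eq_zero hAbar
      -- cancel `pⁿ⁺¹`
      have hAB' : Θ * B' ^ (n + 1) = A' ^ (n + 1) := by
        have : C (p : ℤ_[p]) ^ (n + 1) * (Θ * B' ^ (n + 1)) = C (p : ℤ_[p]) ^ (n + 1) * A' ^ (n + 1) := by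
          have e1 : C (p : ℤ_[p]) ^ (n + 1) * (Θ * B' ^ (n + 1)) = Θ * (C (p : ℤ_[p]) * B') ^ (n + 1) := by ring
          have e2 : C (p : ℤ_[p]) ^ (n + 1) * A' ^ (n + 1) = (C (p : ℤ_[p]) * A') ^ (n + 1) := by ring
          rw [e1, e2, hAB]
        exact mul_left_cancel₀ (pow_ne_zero _ hCp) this
      -- the valuation dropped
      have hB'0 : coeff n₀ B' ≠ 0 := by
        intro h0; apply hB0; rw [coeff_C_mul, h0, mul_zero]
      have hval' : (coeff n₀ B').valuation ≤ k := by
        have hv : (coeff n₀ (C (p : ℤ_[p]) * B')).valuation = 1 + (coeff n₀ B').valuation := by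
          rw [coeff_C_mul, ← pow_one (p : ℤ_[p]), PadicInt.valuation_p_pow_mul 1 _ hB'0]
        rw [hv] at hval; omega
      exact ih A' B' hB'0 hval' hAB'

end Padic

/-! ### §3 The corollary for `IsThreeAdicFracCube` and `ThreeBlind` -/

open Summit.BirchSwinnertonDyer.Rank1Residual.ManinAdditive
open Summit.BirchSwinnertonDyer.Rank1Residual.ManinAdditive.CuspidalKummer
open Summit.BirchSwinnertonDyer.Rank1Residual.ManinAdditive.CuspidalKummerThree

/-- Coefficientwise injectivity of `ℤ₃⟦q⟧ → ℚ₃⟦q⟧`. [folklore] -/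
theorem powerSeries_map_padicInt_injective :
    Function.Injective (PowerSeries.map (PadicInt.Coe.ringHom (p := 3))) := by
  intro F G h
  ext n
  have := congrArg (coeff n) h
  simp only [coeff_map] at this
  exact Subtype.ext this

/-- **Refuter-1 §R66 Lemma 1 / R-2: blindness is a unit-cube condition.**  If `Θ ∈ ℚ⟦q⟧` has a `3`-integral lift `Θ₀ ∈ ℤ₃⟦q⟧`
(`Θ₀ ↦ Θ` under `ℤ₃⟦q⟧ → ℚ₃⟦q⟧ ← ℚ⟦q⟧`) with unit constant term, then `Θ` is a cube in `Frac ℤ₃⟦q⟧` iff `Θ₀ = U³` for a UNIT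
`U ∈ ℤ₃⟦q⟧`. [cite: Washington1997, Thm. 7.3] -/
theorem isThreeAdicFracCube_iff_exists_isUnit_cube (Θ : ℚ⟦X⟧) (Θ₀ : (ℤ_[3])⟦X⟧)
    (hlift : Θ₀.map (PadicInt.Coe.ringHom (p := 3)) = Θ.map (Rat.castHom ℚ_[3])) (h0 : IsUnit (constantCoeff Θ₀)) :
    IsThreeAdicFracCube Θ ↔ ∃ U : (ℤ_[3])⟦X⟧, IsUnit U ∧ Θ₀ = U ^ 3 := by
  have hΘ₀ : IsUnit Θ₀ := PowerSeries.isUnit_iff_constantCoeff.mpr h0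
  constructor
  · rintro ⟨A, B, hB, hAB⟩
    have hAB' : Θ₀ * B ^ 3 = A ^ 3 :=
      powerSeries_map_padicInt_injective (by rw [map_mul, map_pow, map_pow, hlift]; exact hAB)
    exact exists_isUnit_pow_eq_of_mul_pow_eq_pow_padicInt 3 hΘ₀ hB hAB'
  · rintro ⟨U, -, hU⟩
    refine ⟨U, 1, one_ne_zero, ?_⟩
    rw [← hlift, hU, map_pow, map_one, one_pow, mul_one]

/-- The same for `ThreeBlind W X₁ Y₁` (`:= IsThreeAdicFracCube (kummerCubeSeries W 1 X₁ Y₁ X)`): given a `3`-integral lift `Θ₀` of the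
intrinsic Kummer cube series with unit constant term (at additive `3` the intrinsic model is `3`-integral and `Θ♮(0) = −1`),
`T = (X₁, Y₁)` is `3`-blind iff `Θ₀` is the cube of a unit of `ℤ₃⟦q⟧`. [cite: Washington1997, Thm. 7.3] -/
theorem threeBlind_iff_exists_isUnit_cube (W : WeierstrassCurve ℚ) (X₁ Y₁ : ℚ) (Θ₀ : (ℤ_[3])⟦X⟧)
    (hlift : Θ₀.map (PadicInt.Coe.ringHom (p := 3)) = (kummerCubeSeries W 1 X₁ Y₁ X).map (Rat.castHom ℚ_[3]))
    (h0 : IsUnit (constantCoeff Θ₀)) :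
    ThreeBlind W X₁ Y₁ ↔ ∃ U : (ℤ_[3])⟦X⟧, IsUnit U ∧ Θ₀ = U ^ 3 :=
  isThreeAdicFracCube_iff_exists_isUnit_cube _ Θ₀ hlift h0

end Summit.BirchSwinnertonDyer.BirchSwinnertonDyer.Theorems.ManinLocalTwoThree

end
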